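import Summits.BirchSwinnertonDyer.BirchSwinnertonDyer.Theorems.KimAtThreeFineKatoValueEquivarianceStab
import Literature.NumberTheory.GaloisRepresentations.CyclotomicPlacesAbsGalois
import HarnessLib

/-!
# (GAL₀) from LOCAL equivariance at EVERY level (ramified `p ∣ m` included): the stabiliser of a
# place above `p` in `Gal(ℚ(ζ_m)/ℚ)` lies in the image of the decomposition group `D_{𝔓₀} = res(Γ_{ℚ_p})`
# (crux `KatoKuriharaPortThreeShared`, stmt-BirchSwinnertonDyer-19560; cell `bsd-addord`, seat w2-acc5
# gen 5; route W2 `KimAtThreeKolyvagin`; `--supports 19560`, helper)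

HONEST FRAMING.  TOOL theorems only (no definition, no named fact, no `sorry`); every `p`, `k`, `r`;
closes nothing; nothing is booked; BSD is not proved by any of this.

WHAT.  `KimAtThreeFineKatoValueEquivarianceStab.singleField_gal_of_galDecomposition` reduced the
(GAL₀) hypothesis of the (C3a) theorem (`δ̃ • w₀ = w₀ ⟹ F (δ · Y) = δ̃_* (F Y)`) to the decomposition
group (GAL_D) at the TAME levels `p ∤ m` only (Washington 2.13: the stabiliser is `⟨σ_p⟩`).  THIS FILE
removes the tameness hypothesis (`singleField_gal_of_galDecomposition_all`): for ANY level
`m = cycLevel p k r`, if `δ̃ = (ζ ↦ ζ^{χ_m(δ)})` fixes a place `w₀ ∣ p` of `L = ℚ(ζ_m)`, then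
`δ ∈ U · D_{𝔓₀}` (`exists_mem_cycSubgroup_mul_mem_range_of_smul_place_eq`).  Proof (Neukirch I §9, the
transitivity argument, no inertia theory): transport `𝔓₀` and `δ • 𝔓₀` along `ι : \bar ℤ_ℚ ≅ \bar ℤ_L`
(`AbsIntegersEquiv`); the places of `L` under them are `w₁` and `δ̃ • w₁`
(`CyclotomicPlacesAbsGalois.under_comap_smul`: `Γ_ℚ` acts on `ι⁻¹(L)` through `χ_m`); all places above
`p` have the same stabiliser (abelian group, transitive action), so `δ̃ • w₁ = w₁` and both transported
primes lie above `w₁`; `Γ_L` is transitive on those (`exists_smul_eq_of_mem_primesAbove`), giving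
`τ ∈ Γ_L` with `res(τ) · δ ∈ Stab(𝔓₀) = D_{𝔓₀}` (`comap_absIntegersMap_smul`,
`decompositionSubgroup_adicCompletionPrime_eq_range`), and `res(τ) ∈ Gal(ℚ̄/ℚ(μ_m)) ≤ U` acts trivially
on `H¹(U, T)` with `χ_m(res τ) = 1`.  So the Kato-v2 supplier's Galois-side debt for `ZetaBody` (C3a)
of the single-completion `Λ` is (GAL_D) — local `Gal(L_{w₀}/ℚ_p)`-semilinearity of `exp*_{w₀} ∘ loc` —
at every level.

References: J. Neukirch, *Algebraic Number Theory* (1999) Ch. I §9 (9.1)–(9.3), Ch. II §9 (9.6)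
[NeukirchANT1999]; L. C. Washington, *Introduction to Cyclotomic Fields* (1997) Thm. 2.13
[Washington1997]; K. Kato, Astérisque 295 (2004) §9.4 [Kato2004Asterisque].
-/

noncomputable section

-- the cell's Theorems namespace `Summit.BirchSwinnertonDyer.BirchSwinnertonDyer.…` repeats the summit name by design (D-0017)
set_option linter.dupNamespace false

open scoped Classical NumberField ContRepresentation TensorProduct Pointwise
open Field NumberField IsDedekindDomain Polynomial
open WeierstrassCurve Literature.NumberTheory.EllipticCurves Literature.NumberTheory.GaloisRepresentations
  Literature.NumberTheory.GaloisRepresentations.DiscreteGaloisModule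
  Literature.NumberTheory.EllipticCurves.Kato2004.EulerSystemValues
open Literature.NumberTheory.AdelicBaseChange Literature.NumberTheory.Automorphic
open Summit.BirchSwinnertonDyer.Rank1Residual.GaloisImage
open Summit.BirchSwinnertonDyer.BirchSwinnertonDyer.Theorems.KimAtThreeFineKatoValueEquivarianceStab

namespace Summit.BirchSwinnertonDyer.BirchSwinnertonDyer.Theorems.KimAtThreeFineKatoValueEquivarianceStabAll

variable (p : ℕ) [hp : Fact p.Prime] (k : ℕ) (r : Finset (HeightOneSpectrum (𝓞 ℚ)))

/-- `(a * b) • I = a • (b • I)` for the `Γ_ℚ`-action on ideals of `\bar ℤ` (Mathlib `mul_smul`; isolated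
here because the instance search must run at default transparency). -/
private theorem mul_smul_absIdeal (a b : absoluteGaloisGroup ℚ) (I : Ideal (absIntegers (𝓞 ℚ) ℚ)) :
    (a * b) • I = a • b • I :=
  mul_smul a b I

set_option backward.isDefEq.respectTransparency false in
/-- **`Stab(w₀) ⊆ U · D_{𝔓₀}` at every level.**  For `m = cycLevel p k r`, `L = ℚ(ζ_m)`,
`U = cycSubgroup p k r`, a place `w₀ ∣ p` of `L` and `δ ∈ Γ_ℚ` whose image `δ̃ = sigma m (χ_m δ)` fixes
`w₀`: there are `u ∈ U` with `χ_m(u) = 1` and `δ̂ ∈ Γ_{ℚ_v}` with `δ = u · res(δ̂)` (Neukirch I §9: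
transitivity of `Gal(ℚ̄/L)` on the primes above a place of `L`, through `\bar ℤ_ℚ ≅ \bar ℤ_L`).
[cite: NeukirchANT1999, Ch. I §9 (9.1)–(9.3) and Ch. II §9 Prop. (9.6)] -/
theorem exists_mem_cycSubgroup_mul_mem_range_of_smul_place_eq
    (w₀ : ((Rat.HeightOneSpectrum.primesEquiv (R := 𝓞 ℚ)).symm ⟨p, Fact.out⟩).Extension
      (𝓞 (CyclotomicField (cycLevel p k r) ℚ)))
    (δ : absoluteGaloisGroup ℚ)
    (hδ : sigma (cycLevel p k r) (modNCyclotomicCharacter ℚ (cycLevel p k r) δ) • w₀.1 = w₀.1) :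
    ∃ u ∈ cycSubgroup p k r, modNCyclotomicCharacter ℚ (cycLevel p k r) u = 1 ∧
      ∃ δ' : absoluteGaloisGroup (((Rat.HeightOneSpectrum.primesEquiv (R := 𝓞 ℚ)).symm ⟨p, Fact.out⟩).adicCompletion ℚ),
        δ = u * absGaloisRestrict ℚ (((Rat.HeightOneSpectrum.primesEquiv (R := 𝓞 ℚ)).symm ⟨p, Fact.out⟩).adicCompletion ℚ) δ' := by
  let ιi : absIntegers (𝓞 (CyclotomicField (cycLevel p k r) ℚ)) (CyclotomicField (cycLevel p k r) ℚ) →+* absIntegers (𝓞 ℚ) ℚ := (absIntegersEquiv ℚ (CyclotomicField (cycLevel p k r) ℚ)).symm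
  have hcomap : ∀ I : Ideal (absIntegers (𝓞 ℚ) ℚ), (I.comap ιi).comap (absIntegersMap ℚ (CyclotomicField (cycLevel p k r) ℚ)) = I := fun I => by
    rw [Ideal.comap_comap]
    have hc : ιi.comp (absIntegersMap ℚ (CyclotomicField (cycLevel p k r) ℚ)) = RingHom.id _ := by
      ext x
      exact congrArg Subtype.val ((absIntegersEquiv ℚ (CyclotomicField (cycLevel p k r) ℚ)).symm_apply_apply x)
    rw [hc, Ideal.comap_id]
  -- `𝔓₀`, its transport `𝔔₀ = ι_* 𝔓₀` and the place `w₁` of `L` under it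
  have h𝔓₀ : adicCompletionPrime ℚ ((Rat.HeightOneSpectrum.primesEquiv (R := 𝓞 ℚ)).symm ⟨p, Fact.out⟩) ∈ ((Rat.HeightOneSpectrum.primesEquiv (R := 𝓞 ℚ)).symm ⟨p, Fact.out⟩).primesAbove := adicCompletionPrime_mem_primesAbove ℚ ((Rat.HeightOneSpectrum.primesEquiv (R := 𝓞 ℚ)).symm ⟨p, Fact.out⟩)
  haveI : (adicCompletionPrime ℚ ((Rat.HeightOneSpectrum.primesEquiv (R := 𝓞 ℚ)).symm ⟨p, Fact.out⟩)).IsPrime := h𝔓₀.1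
  haveI hQ₀ : ((adicCompletionPrime ℚ ((Rat.HeightOneSpectrum.primesEquiv (R := 𝓞 ℚ)).symm ⟨p, Fact.out⟩)).comap ιi).IsPrime := Ideal.comap_isPrime ιi _
  obtain ⟨w₁, hw₁v, h𝔔₀w₁, hw₁eq⟩ :=
    exists_heightOneSpectrum_of_comap_absIntegersMap_mem_primesAbove (K := ℚ) (M := (CyclotomicField (cycLevel p k r) ℚ))
      (𝔔 := (adicCompletionPrime ℚ ((Rat.HeightOneSpectrum.primesEquiv (R := 𝓞 ℚ)).symm ⟨p, Fact.out⟩)).comap ιi) (by rw [hcomap]; exact h𝔓₀)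
  -- the conjugate prime `δ • 𝔓₀`, its transport `𝔔₁`, and the place under it: `δ̃ • w₁`
  have h𝔓₁ : δ • adicCompletionPrime ℚ ((Rat.HeightOneSpectrum.primesEquiv (R := 𝓞 ℚ)).symm ⟨p, Fact.out⟩) ∈ ((Rat.HeightOneSpectrum.primesEquiv (R := 𝓞 ℚ)).symm ⟨p, Fact.out⟩).primesAbove := smul_mem_primesAbove h𝔓₀ δ
  haveI : (δ • adicCompletionPrime ℚ ((Rat.HeightOneSpectrum.primesEquiv (R := 𝓞 ℚ)).symm ⟨p, Fact.out⟩)).IsPrime := h𝔓₁.1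
  haveI hQ₁ : ((δ • adicCompletionPrime ℚ ((Rat.HeightOneSpectrum.primesEquiv (R := 𝓞 ℚ)).symm ⟨p, Fact.out⟩)).comap ιi).IsPrime := Ideal.comap_isPrime ιi _
  have hunder : ((δ • adicCompletionPrime ℚ ((Rat.HeightOneSpectrum.primesEquiv (R := 𝓞 ℚ)).symm ⟨p, Fact.out⟩)).comap ιi).under (𝓞 (CyclotomicField (cycLevel p k r) ℚ)) =
      sigma (cycLevel p k r) (modNCyclotomicCharacter ℚ (cycLevel p k r) δ) •
        ((adicCompletionPrime ℚ ((Rat.HeightOneSpectrum.primesEquiv (R := 𝓞 ℚ)).symm ⟨p, Fact.out⟩)).comap ιi).under (𝓞 (CyclotomicField (cycLevel p k r) ℚ)) :=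
    CyclotomicField.under_comap_smul (m := cycLevel p k r) δ
      (adicCompletionPrime ℚ ((Rat.HeightOneSpectrum.primesEquiv (R := 𝓞 ℚ)).symm ⟨p, Fact.out⟩))
  -- all places above `p` have the same stabiliser: `δ̃ • w₁ = w₁`
  have hw₀w₁ : w₀.1.under (𝓞 ℚ) = w₁.under (𝓞 ℚ) := by
    rw [w₀.2]
    exact (HeightOneSpectrum.ext hw₁v).symm
  have hw₁fix : sigma (cycLevel p k r) (modNCyclotomicCharacter ℚ (cycLevel p k r) δ) • w₁ = w₁ :=
    (CyclotomicField.smul_place_eq_iff_of_under_eq hw₀w₁ _).mp hδ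
  -- hence `𝔔₁` lies above `w₁` too
  have h𝔔₁w₁ : (δ • adicCompletionPrime ℚ ((Rat.HeightOneSpectrum.primesEquiv (R := 𝓞 ℚ)).symm ⟨p, Fact.out⟩)).comap ιi ∈ w₁.primesAbove := by
    refine ⟨hQ₁, ⟨?_⟩⟩
    rw [hunder, ← hw₁eq, ← HeightOneSpectrum.smul_asIdeal, hw₁fix]
  -- transitivity of `Γ_L` on the primes above `w₁`
  obtain ⟨τ, hτ⟩ := HeightOneSpectrum.exists_smul_eq_of_mem_primesAbove_holds h𝔔₁w₁ h𝔔₀w₁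
  -- back in `Γ_ℚ`: `res τ · δ ∈ Stab(𝔓₀) = D_{𝔓₀} = res(Γ_{ℚ_v})`
  have hD : (absGaloisRestrict ℚ (CyclotomicField (cycLevel p k r) ℚ) τ * δ) • adicCompletionPrime ℚ ((Rat.HeightOneSpectrum.primesEquiv (R := 𝓞 ℚ)).symm ⟨p, Fact.out⟩) = adicCompletionPrime ℚ ((Rat.HeightOneSpectrum.primesEquiv (R := 𝓞 ℚ)).symm ⟨p, Fact.out⟩) := by
    have e1 := comap_absIntegersMap_smul ℚ (CyclotomicField (cycLevel p k r) ℚ) τ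
      ((δ • adicCompletionPrime ℚ ((Rat.HeightOneSpectrum.primesEquiv (R := 𝓞 ℚ)).symm ⟨p, Fact.out⟩)).comap ιi)
    rw [hτ, hcomap, hcomap] at e1
    exact (mul_smul_absIdeal _ _ _).trans e1.symm
  have hDrange : absGaloisRestrict ℚ (CyclotomicField (cycLevel p k r) ℚ) τ * δ ∈ (absGaloisRestrict ℚ (((Rat.HeightOneSpectrum.primesEquiv (R := 𝓞 ℚ)).symm ⟨p, Fact.out⟩).adicCompletion ℚ)).toMonoidHom.range := by
    rw [← decompositionSubgroup_adicCompletionPrime_eq_range]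
    exact Ideal.mem_decompositionSubgroup_iff.mpr hD
  obtain ⟨δ', hδ'⟩ := hDrange
  -- `res τ ∈ Gal(ℚ̄/ℚ(μ_m)) ≤ U`, `χ_m(res τ) = 1`
  have hχτ : modNCyclotomicCharacter ℚ (cycLevel p k r) (absGaloisRestrict ℚ (CyclotomicField (cycLevel p k r) ℚ) τ) = 1 := by
    have hmem := absGaloisRestrict_mem_rootsOfUnityFixer ℚ (CyclotomicField (cycLevel p k r) ℚ)
      (IsCyclotomicExtension.zeta_spec (cycLevel p k r) ℚ (CyclotomicField (cycLevel p k r) ℚ)) τ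
    rw [rootsOfUnityFixer_eq_ker] at hmem
    exact hmem
  have hχτ' : modNCyclotomicCharacter ℚ (cycLevel p k r) (absGaloisRestrict ℚ (CyclotomicField (cycLevel p k r) ℚ) τ)⁻¹ = 1 := by
    rw [map_inv, hχτ, inv_one]
  refine ⟨(absGaloisRestrict ℚ (CyclotomicField (cycLevel p k r) ℚ) τ)⁻¹, mem_cycSubgroup_of_modNCyclotomicCharacter_eq_one p k r _ hχτ',
    hχτ', δ', ?_⟩
  change δ = (absGaloisRestrict ℚ (CyclotomicField (cycLevel p k r) ℚ) τ)⁻¹ * (absGaloisRestrict ℚ (((Rat.HeightOneSpectrum.primesEquiv (R := 𝓞 ℚ)).symm ⟨p, Fact.out⟩).adicCompletion ℚ)).toMonoidHom δ'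
  rw [hδ', inv_mul_cancel_left]

variable (W : WeierstrassCurve ℚ) [W.IsElliptic] [ContinuousSMul ℤ_[p] (W.tateModule p)]

set_option backward.isDefEq.respectTransparency false in
/-- **(GAL₀) ⟸ (GAL_D) at EVERY level** (ramified `p ∣ m` included): the `D`-equivariance hypothesis
of `KimAtThreeFineKatoValueEquivariance.conjMap_eq_map_sigma_of_singleField` — `F (δ · Y) = δ̃_* (F Y)`
for every `δ ∈ Γ_ℚ` whose image fixes the place `w₀` — follows from the same identity for `δ = res(δ̂)`,
`δ̂ ∈ Γ_{ℚ_v}`, alone (`exists_mem_cycSubgroup_mul_mem_range_of_smul_place_eq` and the triviality of `U` on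
`H¹(U, T)`).  Supersedes the tame-level `singleField_gal_of_galDecomposition`.
[cite: NeukirchANT1999, Ch. I §9 (9.1)–(9.3) and Ch. II §9 Prop. (9.6)] -/
theorem singleField_gal_of_galDecomposition_all
    (w₀ : ((Rat.HeightOneSpectrum.primesEquiv (R := 𝓞 ℚ)).symm ⟨p, Fact.out⟩).Extension
      (𝓞 (CyclotomicField (cycLevel p k r) ℚ)))
    (F : H1 (tateRep W p) (cycSubgroup p k r) →+ w₀.1.adicCompletion (CyclotomicField (cycLevel p k r) ℚ))
    (hgalD : ∀ (δ' : absoluteGaloisGroup (((Rat.HeightOneSpectrum.primesEquiv (R := 𝓞 ℚ)).symm ⟨p, Fact.out⟩).adicCompletion ℚ))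
      (hδ : sigma (cycLevel p k r) (modNCyclotomicCharacter ℚ (cycLevel p k r)
        (absGaloisRestrict ℚ (((Rat.HeightOneSpectrum.primesEquiv (R := 𝓞 ℚ)).symm ⟨p, Fact.out⟩).adicCompletion ℚ) δ')) • w₀.1 = w₀.1)
      (Y : H1 (tateRep W p) (cycSubgroup p k r)),
      F (conjMap (tateRep W p).toTopRep (cycSubgroup p k r) (absGaloisRestrict ℚ (((Rat.HeightOneSpectrum.primesEquiv (R := 𝓞 ℚ)).symm ⟨p, Fact.out⟩).adicCompletion ℚ) δ') 1 Y) =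
        galAdicCompletionMap (sigma (cycLevel p k r) (modNCyclotomicCharacter ℚ (cycLevel p k r)
          (absGaloisRestrict ℚ (((Rat.HeightOneSpectrum.primesEquiv (R := 𝓞 ℚ)).symm ⟨p, Fact.out⟩).adicCompletion ℚ) δ'))) hδ (F Y))
    (δ : absoluteGaloisGroup ℚ)
    (hδ : sigma (cycLevel p k r) (modNCyclotomicCharacter ℚ (cycLevel p k r) δ) • w₀.1 = w₀.1)
    (Y : H1 (tateRep W p) (cycSubgroup p k r)) :
    F (conjMap (tateRep W p).toTopRep (cycSubgroup p k r) δ 1 Y) =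
      galAdicCompletionMap (sigma (cycLevel p k r) (modNCyclotomicCharacter ℚ (cycLevel p k r) δ)) hδ (F Y) := by
  obtain ⟨u, hu, hχu, δ', hδeq⟩ := exists_mem_cycSubgroup_mul_mem_range_of_smul_place_eq p k r w₀ δ hδ
  have hsame : sigma (cycLevel p k r) (modNCyclotomicCharacter ℚ (cycLevel p k r) (absGaloisRestrict ℚ (((Rat.HeightOneSpectrum.primesEquiv (R := 𝓞 ℚ)).symm ⟨p, Fact.out⟩).adicCompletion ℚ) δ')) =
      sigma (cycLevel p k r) (modNCyclotomicCharacter ℚ (cycLevel p k r) δ) := by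
    rw [hδeq, map_mul, hχu, one_mul]
  have hδ'fix : sigma (cycLevel p k r) (modNCyclotomicCharacter ℚ (cycLevel p k r)
      (absGaloisRestrict ℚ (((Rat.HeightOneSpectrum.primesEquiv (R := 𝓞 ℚ)).symm ⟨p, Fact.out⟩).adicCompletion ℚ) δ')) • w₀.1 = w₀.1 := by rw [hsame]; exact hδ
  have hconj : conjMap (tateRep W p).toTopRep (cycSubgroup p k r) δ 1 Y =
      conjMap (tateRep W p).toTopRep (cycSubgroup p k r) (absGaloisRestrict ℚ (((Rat.HeightOneSpectrum.primesEquiv (R := 𝓞 ℚ)).symm ⟨p, Fact.out⟩).adicCompletion ℚ) δ') 1 Y := by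
    rw [hδeq, ← conjMap_conjMap, conjMap_eq_self_of_mem_one _ _ hu]
  rw [hconj, hgalD δ' hδ'fix Y]
  exact galAdicCompletionMap_congr_left _ hsame _ _ _

end Summit.BirchSwinnertonDyer.BirchSwinnertonDyer.Theorems.KimAtThreeFineKatoValueEquivarianceStabAll

end
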